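import Summits.MatrixMultiplication.OmegaCensus.SmallFormats.GF2OrbitChecks
import HarnessLib

/-!
# ω-census family (a), GF(2) rank floors: the forced-product check (single products among the input slices)

Cell `pub-omega` (unit `pub-omega-lit`, gen 4), topic `Summits/MatrixMultiplication/OmegaCensus` (sub-folder
`SmallFormats`). Framing (verbatim): lottery ticket; floor = certified bounds/negative ranges. HONEST FRAMING:
replay infrastructure (design note `pub-omega-lit/KERNEL-GF2-FLOORS-DESIGN.md` §7, layer R2); nothing here is
progress on `ω`. PROVED, no facts; the mathematics is Hopcroft–Kerr 1971 Lemma 2 / Wang 2026 §6 "forced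
product", landed as `hopcroftKerr1971_forcedProduct_pi` (`Literature/…/SingleProductExchange.lean`).

For the constrained map `ψ_K : S_K × 𝔽₂^{m×n} → 𝔽₂^{l×n}` consider `ψ♯ : S_K × (𝔽₂^{l×n})^* → 𝔽₂^{m n}`,
`ψ♯(x, ℓ)_b = ℓ(x E_b)` (a computation of `ψ_K` rotates into one of `ψ♯` of the same length). If the slices
`x ↦ x E_{t_j}` (`j < s`, input coordinates `t_j`) are rank one on `S_K`, `x E_{t_j} = (x E_{t_j})_{c_j} · w_j`,
with independent single products, then every computation of `ψ_K` of length `r` yields, for SOME normalised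
coefficient table `cc` (free entries `cc_j(b)`, `b ∉ {t_j}`: `s (m n − s)` bits `α`), a computation of the
residual of length `r − s`; so if for EVERY `α` the output-coordinate flattening of the residual restricted to
the listed rows `sel` is independent (`indepB`), then `r ≥ s + |sel|`. `forcedCheck` is the Boolean test,
`le_of_forcedCheck` its soundness.
-/

namespace Summit.MatrixMultiplication.OmegaCensus.GF2RankLB

open Module Matrix Literature.Computability.AlgebraicComplexity

section Forced

variable (l m n : ℕ) (K : List ℕ)

/-! ## The rotated map `ψ♯` -/

/-- Evaluation of a functional on `𝔽₂^{m×n}` at the standard basis, as a vector indexed by input codes. -/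
def piEval (m n : ℕ) : Module.Dual (ZMod 2) (Matrix (Fin m) (Fin n) (ZMod 2)) →ₗ[ZMod 2] (Fin (m * n) → ZMod 2) :=
  LinearMap.pi fun b => LinearMap.applyₗ (vB m n b)

/-- `ψ♯(x, ℓ) = (b ↦ ℓ(x E_b))`. -/
def sharp : subOf l m K →ₗ[ZMod 2] Module.Dual (ZMod 2) (Matrix (Fin l) (Fin n) (ZMod 2)) →ₗ[ZMod 2]
    (Fin (m * n) → ZMod 2) :=
  (rotateMap (psiK l m n K).flip).compr₂ (piEval m n)

/-- `ψ♯(x, ℓ)_b = ℓ(x E_b)`. -/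
@[simp] theorem sharp_apply (x : subOf l m K) (ℓ : Module.Dual (ZMod 2) (Matrix (Fin l) (Fin n) (ZMod 2)))
    (b : Fin (m * n)) : sharp l m n K x ℓ b = ℓ ((x : Matrix (Fin l) (Fin m) (ZMod 2)) * vB m n b) := by
  simp [sharp, piEval, rotateMap_apply]

/-- A computation of `ψ_K` gives one of `ψ♯` with the same index set. -/
def BilinCompSharp {ι : Type*} [Fintype ι] (β : BilinComp (psiK l m n K) ι) : BilinComp (sharp l m n K) ι :=
  (β.flip.rotate).comap LinearMap.id LinearMap.id (piEval m n) (fun _ _ => rfl)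

/-! ## Certificate data and bit functions -/

variable (ts ws cs xs sel : List ℕ)

/-- Rank-one check for the slice at input code `t`: on `S_K`, `x E_t = (x E_t)_c · w`. -/
def rank1B (t w c : ℕ) : Bool :=
  allLT (fun x => !memB (l * m) K x ||
    allLT (fun c' => tbit m n x t c' == (tbit m n x t c && w.testBit c')) (l * n)) (2 ^ (l * m))

/-- Parity of `∑_j g_j a_j(x) (w_j)_{c'}` for the bit vector `g`. -/
def gsumB (g x c' : ℕ) : Bool :=
  bxor (fun j => g.testBit j && (tbit m n x (ts.getD j 0) (cs.getD j 0) && (ws.getD j 0).testBit c')) ts.length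

/-- Independence check for the single products `a_j ⊗ ev_{w_j}`: every nonzero `g` has a witness `(x, c')`. -/
def indSingleB : Bool :=
  allLT (fun g => g == 0 || !(allLT (fun x => !memB (l * m) K x ||
    allLT (fun c' => !gsumB m n ts ws cs g x c') (l * n)) (2 ^ (l * m)))) (2 ^ ts.length)

/-- The input codes not among the chosen `t_j`. -/
def restL : List ℕ := (List.range (m * n)).filter fun b => !ts.contains b

/-- Index table of the free input codes: `riOf ts` at `b` = position of `b` in `restL` (junk on chosen codes). -/
def riOf : List ℕ := (List.range (m * n)).map fun b => (restL m n ts).findIdx (· == b)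

/-- The coefficient bit `cc_j(b)` encoded by `α`: `δ_{j j'}` on chosen codes `b = t_{j'}`, free otherwise
(`R`, `ri` = the precomputed `(restL).length` and `riOf`, so that the kernel does not recompute them). -/
def ccBit (R : ℕ) (ri : List ℕ) (α j b : ℕ) : Bool :=
  if ts.contains b then ts.getD j 0 == b else α.testBit (j * R + ri.getD b 0)

/-- Entry of the residual: `(ρ_α(x, e_{c'}))_b`. -/
def resBit (R : ℕ) (ri : List ℕ) (α x b c' : ℕ) : Bool :=
  xor (tbit m n x b c')
    (bxor (fun j => tbit m n x (ts.getD j 0) (cs.getD j 0) && (ws.getD j 0).testBit c' && ccBit ts R ri α j b)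
      ts.length)

/-- Row `c'` of the output-coordinate flattening of the residual: columns `(s, b)`, code `b + (m n) s`. -/
def resRow1 (R : ℕ) (ri : List ℕ) (α c' : ℕ) : ℕ :=
  maskOf (fun t => resBit m n ts ws cs R ri α (xs.getD (t / (m * n)) 0) (t % (m * n)) c') (xs.length * (m * n))

/-- The cheap part of the forced-product check (data shape, rank-one slices, independent single products). -/
def forcedPre : Bool :=
  (ws.length == ts.length) && (cs.length == ts.length) && ts.all (· < m * n) && cs.all (· < l * n) &&
  nodupB' ts && xs.all (memB (l * m) K) && sel.all (· < l * n) &&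
  allLT (fun j => rank1B l m n K (ts.getD j 0) (ws.getD j 0) (cs.getD j 0)) ts.length &&
  indSingleB l m n K ts ws cs
where
  /-- duplicate-freeness of a list of naturals -/
  nodupB' : List ℕ → Bool
  | [] => true
  | a :: L => !(L.contains a) && nodupB' L

/-- The expensive part: for EVERY coefficient pattern `α`, the selected residual rows are independent
(stated with the precomputed `R = |restL|` and index table `riOf`). -/
def ResidualsOK : Prop :=
  ∀ α < 2 ^ (ts.length * (restL m n ts).length),
    indepB (sel.map (resRow1 m n ts ws cs xs (restL m n ts).length (riOf m n ts) α)) = true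

/-- The forced-product check (orientation: input slices; residual flattening by output coordinates). -/
def forcedCheck : Bool :=
  forcedPre l m n K ts ws cs xs sel &&
  allLT (fun α => indepB (sel.map (resRow1 m n ts ws cs xs (restL m n ts).length (riOf m n ts) α)))
    (2 ^ (ts.length * (restL m n ts).length))

/-! ## Soundness -/

/-- Every element of `ZMod 2` is `0` or `1`. -/
private theorem zmod2_cases (a : ZMod 2) : a = 0 ∨ a = 1 := by
  fin_cases a
  · exact Or.inl rfl
  · exact Or.inr rfl

/-- `[p] * [q] = [p ∧ q]` in `ZMod 2`. -/
theorem ite_mul_ite (p q : Bool) :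
    ((if p then (1 : ZMod 2) else 0) * if q then 1 else 0) = if (p && q) then 1 else 0 := by
  cases p <;> cases q <;> simp
/-- `[p] - [q] = [p xor q]` in `ZMod 2`. -/
theorem ite_sub_ite (p q : Bool) :
    ((if p then (1 : ZMod 2) else 0) - if q then 1 else 0) = if xor p q then 1 else 0 := by
  cases p <;> cases q <;> decide

/-- `nodupB'` decides `List.Nodup`. -/
theorem nodup_of_nodupB' : ∀ L : List ℕ, forcedPre.nodupB' L = true → L.Nodup
  | [], _ => List.nodup_nil
  | a :: L, h => by
    simp only [forcedPre.nodupB', Bool.and_eq_true, Bool.not_eq_true', ] at h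
    refine List.nodup_cons.2 ⟨fun ha => ?_, nodup_of_nodupB' L h.2⟩
    have := List.contains_iff_mem.2 ha
    rw [h.1] at this
    exact Bool.false_ne_true this

/-- A witness from a failed bounded check. -/
theorem exists_of_allLT_eq_false (p : ℕ → Bool) : ∀ N, allLT p N = false → ∃ x < N, p x = false
  | 0, h => by simp [allLT] at h
  | N + 1, h => by
    simp only [allLT, Bool.and_eq_false_iff] at h
    rcases h with h | h
    · obtain ⟨x, hx, hp⟩ := exists_of_allLT_eq_false p N h
      exact ⟨x, Nat.lt_succ_of_lt hx, hp⟩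
    · exact ⟨N, Nat.lt_succ_self N, h⟩

/-- The output-coordinate functional evaluated on an encoded matrix. -/
theorem eC_ofBits (l n w : ℕ) (c : Fin (l * n)) :
    eC l n c (ofBits l n w) = if w.testBit c then 1 else 0 := by
  simp only [eC, Matrix.entryLinearMap_apply, ofBits_apply, pos, Fin.coe_divNat, Fin.coe_modNat,
    Nat.mod_add_div]

variable {l m n K ts ws cs xs sel}

/-- `divNat`/`modNat` of `finProdFinEquiv (i, k)`. -/
theorem divNat_modNat_finProdFinEquiv {a b : ℕ} (i : Fin a) (k : Fin b) :
    (finProdFinEquiv (i, k)).divNat = i ∧ (finProdFinEquiv (i, k)).modNat = k := by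
  have h := finProdFinEquiv.symm_apply_apply (i, k)
  rw [finProdFinEquiv_symm_apply, Prod.mk.injEq] at h
  exact h

/-- Matrix entries through the output-coordinate functionals. -/
theorem apply_eq_eC {l n : ℕ} (M : Matrix (Fin l) (Fin n) (ZMod 2)) (i : Fin l) (k : Fin n) :
    M i k = eC l n (finProdFinEquiv (i, k)) M := by
  obtain ⟨h1, h2⟩ := divNat_modNat_finProdFinEquiv i k
  simp only [eC, Matrix.entryLinearMap_apply, h1, h2]

/-- Soundness of the rank-one check: `x E_t = (x E_t)_c · w` on `S_K`. -/
theorem mul_vB_eq_of_rank1B {t w c : ℕ} (h : rank1B l m n K t w c = true) (ht : t < m * n)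
    (hc : c < l * n) : ∀ X : Matrix (Fin l) (Fin m) (ZMod 2), X ∈ subOf l m K →
      X * vB m n ⟨t, ht⟩ = (eC l n ⟨c, hc⟩ (X * vB m n ⟨t, ht⟩)) • ofBits l n w := by
  rw [forall_matrix_iff]
  intro x hx hmem
  rw [ofBits_mem_subOf_iff] at hmem
  rw [rank1B, allLT_iff] at h
  have h1 := h x hx
  simp only [hmem, Bool.not_true, Bool.false_or, allLT_iff, beq_iff_eq] at h1
  ext i k'
  have hc' : pos n i k' < l * n := by
    have := (finProdFinEquiv (i, k')).2
    rwa [← pos_eq] at this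
  rw [Matrix.smul_apply, apply_eq_eC (ofBits l m x * vB m n ⟨t, ht⟩), eC_mul_vB, eC_mul_vB, ofBits_apply,
    smul_eq_mul, ite_mul_ite, ← pos_eq, h1 _ hc']

section Families

variable (hts : ∀ j : Fin ts.length, ts.getD j 0 < m * n) (hcs : ∀ j : Fin ts.length, cs.getD j 0 < l * n)

/-- The forms `a_j(x) = (x E_{t_j})_{c_j}` on `S_K`. -/
def aF (j : Fin ts.length) : Module.Dual (ZMod 2) (subOf l m K) :=
  (eC l n ⟨cs.getD j 0, hcs j⟩).comp ((psiK l m n K).flip (vB m n ⟨ts.getD j 0, hts j⟩))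

/-- `a_j` on an encoded element. -/
theorem aF_apply (j : Fin ts.length) (x : subOf l m K) :
    aF hts hcs j x = eC l n ⟨cs.getD j 0, hcs j⟩ ((x : Matrix (Fin l) (Fin m) (ZMod 2)) *
      vB m n ⟨ts.getD j 0, hts j⟩) := by
  simp [aF]

/-- The functionals `b_j = ev_{w_j}` on `(𝔽₂^{l×n})^*`. -/
def bF (l n : ℕ) (ws : List ℕ) (s : ℕ) (j : Fin s) :
    Module.Dual (ZMod 2) (Module.Dual (ZMod 2) (Matrix (Fin l) (Fin n) (ZMod 2))) :=
  Module.Dual.eval (ZMod 2) _ (ofBits l n (ws.getD j 0))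

/-- The chosen input codes as an embedding (duplicate-free list). -/
def kap (hnd : ts.Nodup) : Fin ts.length ↪ Fin (m * n) :=
  ⟨fun j => ⟨ts.getD j 0, hts j⟩, fun j j' hjj => by
    have h := congrArg Fin.val hjj
    simp only [List.getD_eq_getElem _ _ j.2, List.getD_eq_getElem _ _ j'.2] at h
    exact Fin.ext ((List.Nodup.getElem_inj_iff hnd).1 h)⟩

/-- Independence of the single products from `indSingleB`. -/
theorem hind_of_indSingleB (h : indSingleB l m n K ts ws cs = true) (g : Fin ts.length → ZMod 2)
    (hg : ∀ (u : subOf l m K) (v : Module.Dual (ZMod 2) (Matrix (Fin l) (Fin n) (ZMod 2))),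
      ∑ j, g j * (aF hts hcs j u * bF l n ws ts.length j v) = 0) : ∀ j, g j = 0 := by
  rw [← vecOf_bitsOfVec g] at hg ⊢
  set gm := bitsOfVec g with hgm
  have hlt : gm < 2 ^ ts.length := bitsOfVec_lt g
  rw [indSingleB, allLT_iff] at h
  have h1 := h gm hlt
  rw [Bool.or_eq_true, beq_iff_eq] at h1
  rcases h1 with h1 | h1
  · intro j; simp [h1, vecOf]
  · exfalso
    rw [Bool.not_eq_true'] at h1
    obtain ⟨x, hx, h2⟩ := exists_of_allLT_eq_false _ _ h1
    rw [Bool.or_eq_false_iff, Bool.not_eq_false'] at h2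
    obtain ⟨hmem, h3⟩ := h2
    obtain ⟨c', hc', h4⟩ := exists_of_allLT_eq_false _ _ h3
    rw [Bool.not_eq_false'] at h4
    have h5 := hg (elemOf l m K x hmem) (eC l n ⟨c', hc'⟩)
    have h6 : ∀ j : Fin ts.length, vecOf ts.length gm j * (aF hts hcs j (elemOf l m K x hmem) *
        bF l n ws ts.length j (eC l n ⟨c', hc'⟩))
        = if (gm.testBit j && (tbit m n x (ts.getD j 0) (cs.getD j 0) && (ws.getD j 0).testBit c'))
          then 1 else 0 := by
      intro j
      rw [aF_apply, bF, Module.Dual.eval_apply, eC_ofBits]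
      simp only [elemOf, eC_mul_vB, vecOf, ite_mul_ite]
    rw [Finset.sum_congr rfl (fun j _ => h6 j)] at h5
    rw [Fin.sum_univ_eq_sum_range (fun j => if (gm.testBit j && (tbit m n x (ts.getD j 0) (cs.getD j 0) &&
      (ws.getD j 0).testBit c')) then (1 : ZMod 2) else 0), sum_ite_range] at h5
    change (if gsumB m n ts ws cs gm x c' then (1 : ZMod 2) else 0) = 0 at h5
    rw [h4] at h5
    exact one_ne_zero h5

/-- The coordinate identity `ψ♯(u, v)_{t_j} = a_j(u) b_j(v)` from the rank-one checks. -/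
theorem hcoord_of_rank1 (hnd : ts.Nodup) {ws' : List ℕ} (hw : ws' = ws)
    (h1 : ∀ j : Fin ts.length, rank1B l m n K (ts.getD j 0) (ws.getD j 0) (cs.getD j 0) = true)
    (j : Fin ts.length) (u : subOf l m K) (v : Module.Dual (ZMod 2) (Matrix (Fin l) (Fin n) (ZMod 2))) :
    sharp l m n K u v (kap hts hnd j) = aF hts hcs j u * bF l n ws' ts.length j v := by
  subst hw
  rw [sharp_apply, aF_apply, bF, Module.Dual.eval_apply]
  change v ((u : Matrix (Fin l) (Fin m) (ZMod 2)) * vB m n ⟨ts.getD j 0, hts j⟩) = _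
  have hr := mul_vB_eq_of_rank1B (h1 j) (hts j) (hcs j) u u.2
  conv_lhs => rw [hr]
  rw [map_smul, smul_eq_mul]

end Families

/-- Entry formula for the residual with coefficient table encoded by `α`. -/
theorem residual_entry (hts : ∀ j : Fin ts.length, ts.getD j 0 < m * n)
    (hcs : ∀ j : Fin ts.length, cs.getD j 0 < l * n)
    (cc : Fin ts.length → Fin (m * n) → ZMod 2) (α : ℕ)
    (hcc : ∀ j b, cc j b = if ccBit ts (restL m n ts).length (riOf m n ts) α j b then 1 else 0)
    {x : ℕ} (hx : memB (l * m) K x = true) (b : Fin (m * n)) (c' : Fin (l * n)) :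
    residual (sharp l m n K) (aF hts hcs) (bF l n ws ts.length) cc (elemOf l m K x hx) (eC l n c') b
      = if resBit m n ts ws cs (restL m n ts).length (riOf m n ts) α x b c' then 1 else 0 := by
  rw [residual_apply, Pi.sub_apply, Finset.sum_apply, sharp_apply]
  simp only [Pi.smul_apply, smul_eq_mul, elemOf, eC_mul_vB, aF_apply, bF, Module.Dual.eval_apply,
    eC_ofBits, hcc, ite_mul_ite]
  rw [Fin.sum_univ_eq_sum_range (fun j => if (tbit m n x (ts.getD j 0) (cs.getD j 0) &&
    (ws.getD j 0).testBit c' && ccBit ts (restL m n ts).length (riOf m n ts) α j b) then (1 : ZMod 2) else 0),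
    sum_ite_range, ite_sub_ite]
  rfl

/-- The coefficient bits of a normalised table. -/
theorem ccBit_spec (hnd : ts.Nodup) (hts : ∀ j : Fin ts.length, ts.getD j 0 < m * n)
    (cc : Fin ts.length → Fin (m * n) → ZMod 2)
    (hnorm : ∀ j j', cc j (kap hts hnd j') = if j = j' then 1 else 0) :
    ∃ α < 2 ^ (ts.length * (restL m n ts).length), ∀ j b,
      cc j b = if ccBit ts (restL m n ts).length (riOf m n ts) α j b then 1 else 0 := by
  classical
  refine ⟨maskOf (fun p => decide ((if hj : p / (restL m n ts).length < ts.length then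
      if hb : (restL m n ts).getD (p % (restL m n ts).length) 0 < m * n then
        cc ⟨_, hj⟩ ⟨_, hb⟩ else 0 else (0 : ZMod 2)) = 1)) (ts.length * (restL m n ts).length),
    maskOf_lt _ _, fun j b => ?_⟩
  by_cases hb : ts.contains b = true
  · -- a chosen coordinate: `b = t_{j'}`
    obtain ⟨j', hj', hjb⟩ := List.getElem_of_mem (List.contains_iff_mem.1 hb)
    have hb' : b = kap hts hnd ⟨j', hj'⟩ := by
      apply Fin.ext; simp [kap, hjb]
    rw [hb', hnorm]
    simp only [ccBit, kap, Function.Embedding.coeFn_mk, List.getD_eq_getElem _ _ hj', hjb, hb, if_true]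
    have e : (ts.getD j 0 == (b : ℕ)) = decide (j = ⟨j', hj'⟩) := by
      rw [List.getD_eq_getElem _ _ j.2]
      by_cases hjj : j = ⟨j', hj'⟩
      · subst hjj; simp [hjb]
      · have : ts[(j : ℕ)] ≠ (b : ℕ) := by
          rw [← hjb]
          intro hh
          exact hjj (Fin.ext ((List.Nodup.getElem_inj_iff hnd).1 hh))
        simp [hjj, this]
    rw [e]
    by_cases hjj : j = ⟨j', hj'⟩ <;> simp [hjj]
  · -- a free coordinate
    rw [Bool.not_eq_true] at hb
    have hnot : (b : ℕ) ∉ ts := fun hm => by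
      have h' := List.contains_iff_mem.2 hm
      rw [hb] at h'
      exact Bool.false_ne_true h'
    have hbR : (b : ℕ) ∈ restL m n ts := by
      refine List.mem_filter.2 ⟨List.mem_range.2 b.2, ?_⟩
      simpa using hnot
    have hqlt : (restL m n ts).findIdx (· == (b : ℕ)) < (restL m n ts).length :=
      List.findIdx_lt_length_of_exists ⟨b, hbR, by simp⟩
    have hqb : (restL m n ts).getD ((restL m n ts).findIdx (· == (b : ℕ))) 0 = b := by
      rw [List.getD_eq_getElem _ _ hqlt]
      have := @List.findIdx_getElem _ (fun y => y == (b : ℕ)) (restL m n ts) hqlt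
      simpa using this
    have hri : (riOf m n ts).getD b 0 = (restL m n ts).findIdx (· == (b : ℕ)) := by
      rw [riOf, List.getD_eq_getElem _ _ (by simp)]
      simp only [List.getElem_map, List.getElem_range]
    set R := (restL m n ts).length with hRdef
    set q := (restL m n ts).findIdx (· == (b : ℕ)) with hq
    have hR : 0 < R := lt_of_le_of_lt (Nat.zero_le _) hqlt
    have hp1 : ((j : ℕ) * R + q) / R = j := by
      rw [Nat.add_comm, Nat.add_mul_div_right _ _ hR, Nat.div_eq_of_lt hqlt, zero_add]
    have hp2 : ((j : ℕ) * R + q) % R = q := by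
      rw [Nat.add_comm, Nat.add_mul_mod_self_right, Nat.mod_eq_of_lt hqlt]
    have hp3 : (j : ℕ) * R + q < ts.length * R := by
      calc (j : ℕ) * R + q < (j : ℕ) * R + R := by omega
        _ = ((j : ℕ) + 1) * R := by ring
        _ ≤ ts.length * R := Nat.mul_le_mul_right _ j.2
    simp only [ccBit, hb, Bool.false_eq_true, if_false, hri, testBit_maskOf, hp3, decide_true,
      Bool.true_and, hp1, hp2, hqb, j.2, b.2, dif_pos, Fin.eta]
    rcases zmod2_cases (cc j b) with h0 | h1
    · rw [h0]; simp
    · rw [h1]; simp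

/-- **Soundness of the forced product** (cheap check + residual obligation): every computation of `ψ_K` has at
least `s + |sel|` products. -/
theorem le_of_forcedPre (h : forcedPre l m n K ts ws cs xs sel = true) (h3 : ResidualsOK m n ts ws cs xs sel)
    (r : ℕ) (β : BilinComp (psiK l m n K) (Fin r)) : ts.length + sel.length ≤ r := by
  classical
  simp only [forcedPre, Bool.and_eq_true, beq_iff_eq, List.all_eq_true, decide_eq_true_eq] at h
  obtain ⟨⟨⟨⟨⟨⟨⟨⟨hws, hcs0⟩, hts⟩, hcs⟩, hnd⟩, hxs⟩, hsel⟩, h1⟩, h2⟩ := h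
  have hnd' : ts.Nodup := nodup_of_nodupB' ts hnd
  have hts' : ∀ j : Fin ts.length, ts.getD j 0 < m * n := fun j => by
    rw [List.getD_eq_getElem _ _ j.2]; exact hts _ (List.getElem_mem j.2)
  have hcs' : ∀ j : Fin ts.length, cs.getD j 0 < l * n := fun j => by
    have hj : (j : ℕ) < cs.length := by rw [hcs0]; exact j.2
    rw [List.getD_eq_getElem _ _ hj]; exact hcs _ (List.getElem_mem hj)
  rw [allLT_iff] at h1
  have h1' : ∀ j : Fin ts.length, rank1B l m n K (ts.getD j 0) (ws.getD j 0) (cs.getD j 0) = true :=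
    fun j => h1 j j.2
  -- Hopcroft–Kerr: strip the single products
  obtain ⟨cc, r', hnorm, hr, ⟨βr⟩⟩ := hopcroftKerr1971_forcedProduct_pi (BilinCompSharp l m n K β)
    (kap hts' hnd') (aF hts' hcs') (bF l n ws ts.length) (hind_of_indSingleB hts' hcs' h2)
    (hcoord_of_rank1 hts' hcs' hnd' rfl h1')
  simp only [Fintype.card_fin] at hr
  -- the coefficient table is one of the enumerated `α`
  obtain ⟨α, hα, hcc⟩ := ccBit_spec hnd' hts' cc hnorm
  have hind := h3 α hα
  -- flattening of the residual by output coordinates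
  have hxs' : ∀ i : Fin xs.length, memB (l * m) K (xs.getD i 0) = true := fun i => by
    rw [List.getD_eq_getElem _ _ i.2]; exact hxs _ (List.getElem_mem i.2)
  have hsel' : ∀ i : Fin sel.length, sel.getD i 0 < l * n := fun i => by
    rw [List.getD_eq_getElem _ _ i.2]; exact hsel _ (List.getElem_mem i.2)
  let ρ := residual (sharp l m n K) (aF hts' hcs') (bF l n ws ts.length) cc
  let E := (finProdFinEquiv : Fin xs.length × Fin (m * n) ≃ Fin (xs.length * (m * n)))
  have hle : sel.length ≤ finrank (ZMod 2) (LinearMap.range ρ.flip) := by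
    refine le_finrank_range_of_indepB ρ.flip (fun i => eC l n ⟨sel.getD i 0, hsel' i⟩)
      (fun t => elemOf l m K (xs.getD (E.symm t).1 0) (hxs' _)) (fun t => LinearMap.proj (E.symm t).2)
      (fun i t => resBit m n ts ws cs (restL m n ts).length (riOf m n ts) α (xs.getD (t / (m * n)) 0)
        (t % (m * n)) (sel.getD i 0)) ?_ ?_
    · intro i t
      simp only [LinearMap.flip_apply, LinearMap.proj_apply, E, finProdFinEquiv_symm_apply]
      rw [residual_entry hts' hcs' cc α hcc]
      simp [Fin.coe_divNat, Fin.coe_modNat]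
    · change indepB (List.ofFn fun i : Fin sel.length =>
        resRow1 m n ts ws cs xs (restL m n ts).length (riOf m n ts) α (sel.getD i 0)) = true
      rw [ofFn_getD_map]
      exact hind
  have := hle.trans βr.flip.finrank_range_le_card
  simp only [Fintype.card_fin] at this
  omega

/-- Soundness of the monolithic forced-product check. -/
theorem le_of_forcedCheck (h : forcedCheck l m n K ts ws cs xs sel = true) (r : ℕ)
    (β : BilinComp (psiK l m n K) (Fin r)) : ts.length + sel.length ≤ r := by
  rw [forcedCheck, Bool.and_eq_true, allLT_iff] at h
  exact le_of_forcedPre h.1 h.2 r β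

end Forced

end Summit.MatrixMultiplication.OmegaCensus.GF2RankLB
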